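import Summits.HubbardSuperconductivity.HubbardSuperconductivity.Theorems.WidthHaldaneTubeBlochBound

/-!
# The kinetic floor: under a stiffness floor, every sector ground state carries longitudinal
# kinetic energy at least `d₀` per bond

Crux `WidthHaldaneBridge` (stmt-HubbardSuperconductivity-16311) has the hypothesis `UniformThermo`,
whose stiffness clause `d₀ ≤ ρ̃_{L,M} = 2L[E(π/3) - E(0)]/((π/3)² M)` is a floor on a difference of
sector MINIMA. Crux idea `twist-transfer-floors` (2026-08-17 round; also strategist census gen 1, S2
`KineticFloor`) observes that the variational principle transfers this floor onto every `θ = 0`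
ground state `ψ`: pricing the gauge-rotated copies `W_{±θ}ᴴ ψ` in the twisted tube and averaging the
two orientations (the bond currents cancel, `E(-θ) = E(θ)`) gives

  `E(θ) - E(0) ≤ (1 - cos(θ/L)) · K_ψ`,
  `K_ψ = Σ_{a,b,σ} Re⟨ψ, (c†_{(a,b)σ} c_{(a-1,b)σ} + c†_{(a-1,b)σ} c_{(a,b)σ}) ψ⟩`

(the longitudinal kinetic energy of `ψ`, both orientations of every longitudinal bond; `tubeH0 ⊇ -K`),
i.e. the Bloch bound of `Theorems/WidthHaldaneTubeBlochBound.lean` with the actual hopping amplitudes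
of `ψ` kept instead of their a-priori bound `½`. With `1 - cos x ≤ x²/2` and the floor `0 < d₀ ≤ ρ̃`:

  **`d₀ · L · M ≤ K_ψ`**  — the lattice f-sum inequality `D_s/π ≤ ⟨-k_x⟩` (Scalapino–White–Zhang
  1993; Paramekanti–Trivedi–Randeria 1998, eq. (ke-bd)) read as a CONSTRAINT ON `ψ`.

Everything is PROVED here (no definition, no named fact):

* `summand_pm_eq` — pointwise, the `±θ` weights add up to `(2 - 2cos(θ/L))` on the (exactly one)
  longitudinal orientation of an adjacent pair and to `0` transversally (`L ≥ 3`);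
* `sum_longitudinal_eq`, `sum_longitudinal_mul_eq` — the longitudinal hop sum in column
  coordinates equals `K_ψ`;
* `two_mul_tubeEnergy_le_kinetic` — `2E(θ) ≤ 2Re⟨ψ, H₀ψ⟩ + (2 - 2cos(θ/L))·K_ψ` for every unit
  sector vector `ψ`; `tubeEnergy_sub_le_kinetic` — `E(θ) - E(0) ≤ (1 - cos(θ/L))·K_ψ` for every
  normalised sector ground state;
* **`kineticFloor_of_stiffness`** — `0 < d₀ ≤ ρ̃_{L,M}(U,δ)` ⇒ `d₀·L·M ≤ K_ψ` for every normalised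
  `(N_{L,M}(δ), S^z = 0)` ground state; `uniformThermo_kineticFloor` — the same under `UniformThermo`
  at every admissible size; `kineticFloor` — closed form (the registered sub-goal).

By the strategist's F5 this floor is one-body and holds for metals too: a handle for the lines of the
crux, not progress on its open core.

References: D. J. Scalapino, S. R. White, S. C. Zhang, PRB 47 (1993) 7995, §II; A. Paramekanti,
N. Trivedi, M. Randeria, PRB 57 (1998) 11639, §III eq. (ke-bd); D. Bohm, Phys. Rev. 75 (1949) 502;
H. Watanabe, J. Stat. Phys. 177 (2019) 717, §2.2, §4.1.
-/

noncomputable section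

namespace Summit.HubbardSuperconductivity.HubbardSuperconductivity.Theorems.WidthHaldane

set_option linter.dupNamespace false -- summit = problem name (single-conjunct summit), D-0017

open scoped BigOperators Classical Matrix ComplexConjugate
open Matrix Literature.MathematicalPhysics.QuantumLattice

section KineticFloor

variable (L M : ℕ) [NeZero L] [NeZero M] (Λ : Type) [LinearOrder Λ] [Fintype Λ]
  (e : Λ ≃ ZMod L × ZMod M)

omit [NeZero L] [NeZero M] [Fintype Λ] in
/-- **The `±` weights, pointwise and exactly** (`L ≥ 3`): on an adjacent pair the two orientations of
the flux weigh the amplitude `h` by `(2 - 2cos(θ/L))·Re h` on the (exactly one) longitudinal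
orientation and by `0` transversally; non-adjacent pairs contribute nothing on either side.
[cite: Watanabe2019, §2.2.1 (twist operator U_m)] -/
theorem summand_pm_eq (hL : 3 ≤ L) (θ : ℝ) (x y : Λ) (h : ℂ) :
    (if (tubeGraph e).Adj x y then
        ((1 - (if (e x).1 = (e y).1 + 1 ∧ (e x).2 = (e y).2 then Complex.exp (((θ / L : ℝ) : ℂ) * Complex.I)
          else if (e y).1 = (e x).1 + 1 ∧ (e x).2 = (e y).2 then Complex.exp (-(((θ / L : ℝ) : ℂ) * Complex.I))
          else 1)) * h).re else 0) +
      (if (tubeGraph e).Adj x y then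
        ((1 - (if (e x).1 = (e y).1 + 1 ∧ (e x).2 = (e y).2 then Complex.exp ((((-θ) / L : ℝ) : ℂ) * Complex.I)
          else if (e y).1 = (e x).1 + 1 ∧ (e x).2 = (e y).2 then Complex.exp (-((((-θ) / L : ℝ) : ℂ) * Complex.I))
          else 1)) * h).re else 0) =
      (2 - 2 * Real.cos (θ / L)) *
        (((if (e x).1 = (e y).1 + 1 ∧ (e x).2 = (e y).2 then 1 else 0) +
          (if (e y).1 = (e x).1 + 1 ∧ (e x).2 = (e y).2 then 1 else 0)) * h.re) := by
  haveI : Fact (1 < L) := ⟨by omega⟩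
  rw [peierlsWeight_neg]
  -- coordinates
  obtain ⟨⟨a, b⟩, rfl⟩ := e.symm.surjective x
  obtain ⟨⟨a', b'⟩, rfl⟩ := e.symm.surjective y
  by_cases hadj : (tubeGraph e).Adj (e.symm (a, b)) (e.symm (a', b'))
  · rw [if_pos hadj, if_pos hadj, re_pm_pointwise, peierlsWeight_re]
    simp only [Equiv.apply_symm_apply, SimpleGraph.fromRel_adj, tubeGraph, ne_eq,
      EmbeddingLike.apply_eq_iff_eq, Prod.mk.injEq] at hadj ⊢
    by_cases h1 : a = a' + 1 ∧ b = b'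
    · have h2 : ¬ (a' = a + 1 ∧ b = b') := fun h2 => not_both_steps L hL h1.1 h2.1
      rw [if_pos (Or.inl h1), if_pos h1, if_neg h2]
      ring
    · by_cases h2 : a' = a + 1 ∧ b = b'
      · rw [if_pos (Or.inr h2), if_neg h1, if_pos h2]
        ring
      · rw [if_neg (fun h => h.elim h1 h2), if_neg h1, if_neg h2]
        ring
  · rw [if_neg hadj, if_neg hadj]
    simp only [Equiv.apply_symm_apply, SimpleGraph.fromRel_adj, tubeGraph, ne_eq,
      EmbeddingLike.apply_eq_iff_eq, Prod.mk.injEq] at hadj ⊢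
    -- a longitudinal pair would be adjacent
    have h1 : ¬ (a = a' + 1 ∧ b = b') := fun h =>
      hadj ⟨fun h0 => one_ne_zero (by linear_combination h.1.symm.trans h0.1 : (1 : ZMod L) = 0),
        Or.inr (Or.inl h)⟩
    have h2 : ¬ (a' = a + 1 ∧ b = b') := fun h =>
      hadj ⟨fun h0 => one_ne_zero (by linear_combination h.1.symm.trans h0.1.symm : (1 : ZMod L) = 0),
        Or.inl (Or.inl ⟨h.1, h.2.symm⟩)⟩
    rw [if_neg h1, if_neg h2]
    ring

omit [NeZero L] [NeZero M] [LinearOrder Λ] [Fintype Λ] in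
/-- `x = y + e₁` iff `y = x - e₁` (in the labelling `e`). [folklore] -/
theorem longitudinal_iff_left (x y : Λ) :
    ((e x).1 = (e y).1 + 1 ∧ (e x).2 = (e y).2) ↔ y = e.symm ((e x).1 - 1, (e x).2) := by
  rw [Equiv.eq_symm_apply, Prod.ext_iff]
  constructor
  · rintro ⟨h1, h2⟩
    exact ⟨eq_sub_of_add_eq h1.symm, h2.symm⟩
  · rintro ⟨h1, h2⟩
    exact ⟨by rw [h1, sub_add_cancel], h2.symm⟩

omit [NeZero L] [NeZero M] [LinearOrder Λ] [Fintype Λ] in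
/-- `y = x + e₁` iff `y = x + e₁` (in the labelling `e`). [folklore] -/
theorem longitudinal_iff_right (x y : Λ) :
    ((e y).1 = (e x).1 + 1 ∧ (e x).2 = (e y).2) ↔ y = e.symm ((e x).1 + 1, (e x).2) := by
  rw [Equiv.eq_symm_apply, Prod.ext_iff]
  constructor
  · rintro ⟨h1, h2⟩
    exact ⟨h1, h2.symm⟩
  · rintro ⟨h1, h2⟩
    exact ⟨h1, h2.symm⟩

/-- **The longitudinal hop sum in column coordinates**: summing an amplitude `r(x, y, σ)` over the
ordered longitudinal pairs (`x = y + e₁` or `y = x + e₁`) is the column sum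
`Σ_{a,b,σ} (r((a,b),(a-1,b),σ) + r((a-1,b),(a,b),σ))`. [folklore] -/
theorem sum_longitudinal_eq (r : Λ → Λ → Fin 2 → ℝ) :
    ∑ x : Λ, ∑ y : Λ, ∑ σ : Fin 2,
        ((if (e x).1 = (e y).1 + 1 ∧ (e x).2 = (e y).2 then 1 else 0) +
          (if (e y).1 = (e x).1 + 1 ∧ (e x).2 = (e y).2 then 1 else 0)) * r x y σ =
      ∑ a : ZMod L, ∑ b : ZMod M, ∑ σ : Fin 2,
        (r (e.symm (a, b)) (e.symm (a - 1, b)) σ + r (e.symm (a - 1, b)) (e.symm (a, b)) σ) := by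
  -- split the two orientations and evaluate the `y`-sums
  have hx : ∀ x : Λ, ∑ y : Λ, ∑ σ : Fin 2,
      ((if (e x).1 = (e y).1 + 1 ∧ (e x).2 = (e y).2 then 1 else 0) +
        (if (e y).1 = (e x).1 + 1 ∧ (e x).2 = (e y).2 then 1 else 0)) * r x y σ =
      ∑ σ : Fin 2, (r x (e.symm ((e x).1 - 1, (e x).2)) σ + r x (e.symm ((e x).1 + 1, (e x).2)) σ) := by
    intro x
    rw [Finset.sum_comm]
    refine Finset.sum_congr rfl fun σ _ => ?_
    simp only [longitudinal_iff_left, longitudinal_iff_right, add_mul, boole_mul,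
      Finset.sum_add_distrib, Finset.sum_ite_eq', Finset.mem_univ, if_true]
  simp only [hx, Finset.sum_add_distrib]
  -- pass to coordinates `x = e.symm (a, b)`
  have hcoord : ∀ F : Λ → ℝ, ∑ x : Λ, F x = ∑ a : ZMod L, ∑ b : ZMod M, F (e.symm (a, b)) := by
    intro F
    rw [← Fintype.sum_prod_type', ← Equiv.sum_comp e.symm]
  rw [hcoord, hcoord]
  simp only [Equiv.apply_symm_apply]
  congr 1
  -- second orientation: shift the column index `a ↦ a + 1`
  refine Fintype.sum_equiv (Equiv.addRight (1 : ZMod L)) _ _ (fun a => ?_)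
  simp only [Equiv.coe_addRight, add_sub_cancel_right]

/-- `sum_longitudinal_eq` with a constant weight pulled out. [folklore] -/
theorem sum_longitudinal_mul_eq (K : ℝ) (r : Λ → Λ → Fin 2 → ℝ) :
    ∑ x : Λ, ∑ y : Λ, ∑ σ : Fin 2, K *
        (((if (e x).1 = (e y).1 + 1 ∧ (e x).2 = (e y).2 then 1 else 0) +
          (if (e y).1 = (e x).1 + 1 ∧ (e x).2 = (e y).2 then 1 else 0)) * r x y σ) =
      K * ∑ a : ZMod L, ∑ b : ZMod M, ∑ σ : Fin 2,
        (r (e.symm (a, b)) (e.symm (a - 1, b)) σ + r (e.symm (a - 1, b)) (e.symm (a, b)) σ) := by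
  rw [← sum_longitudinal_eq, Finset.mul_sum]
  refine Finset.sum_congr rfl fun x _ => ?_
  rw [Finset.mul_sum]
  refine Finset.sum_congr rfl fun y _ => ?_
  rw [Finset.mul_sum]

/-- **The variational price of the flux with the actual hopping amplitudes** (`L ≥ 3`): for every
unit vector `ψ` of the sector `(N, S^z = 0)` and every flux `θ`,
`2E_{L,M}(U; θ, N) ≤ 2Re⟨ψ, H₀ψ⟩ + (2 - 2cos(θ/L))·K_ψ` — price the gauge-rotated copies `W_{±θ}ᴴψ`
in `H₀ + Tw_{±θ}` and add (the bond currents cancel; the Bloch bound of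
`WidthHaldaneTubeBlochBound` before its amplitude estimate). [cite: Watanabe2019, §2.2.3 and §4.1] -/
theorem two_mul_tubeEnergy_le_kinetic (hL : 3 ≤ L) (U θ : ℝ) (N : ℕ) {ψ : Fock (Orb Λ)}
    (hψ : ψ ∈ szSector N 0) (h1 : star ψ ⬝ᵥ ψ = 1) :
    2 * tubeEnergy L M Λ e U θ N ≤ 2 * (expect (tubeH0 L M Λ e U) ψ).re +
      (2 - 2 * Real.cos (θ / L)) * ∑ a : ZMod L, ∑ b : ZMod M, ∑ σ : Fin 2,
        (expect (creation (orb (e.symm (a, b)) σ) * annihilation (orb (e.symm (a - 1, b)) σ) +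
          creation (orb (e.symm (a - 1, b)) σ) * annihilation (orb (e.symm (a, b)) σ)) ψ).re := by
  -- the variational bound in the twist gauge, for both orientations of the flux
  have hgauge : ∀ θ' : ℝ, tubeEnergy L M Λ e U θ' N ≤
      (expect (phaseGauge (fun z : Λ => Circle.exp (θ' / L * ((e z).1.val : ℝ))) *
        (tubeH0 L M Λ e U + tubeTwist L M Λ e θ') *
        (phaseGauge (fun z : Λ => Circle.exp (θ' / L * ((e z).1.val : ℝ))))ᴴ) ψ).re := by
    intro θ'
    set g : Λ → Circle := fun z : Λ => Circle.exp (θ' / L * ((e z).1.val : ℝ)) with hg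
    have hunit := minEnergyOn_szSector_phaseGauge_conj g⁻¹ (tubeH0 L M Λ e U + tubeTwist L M Λ e θ') N 0
    rw [phaseGauge_conjTranspose, inv_inv, ← phaseGauge_conjTranspose g] at hunit
    rw [tubeEnergy_eq, ← hunit]
    exact minEnergyOn_le_rayleigh_of_mem
      (Matrix.isHermitian_mul_mul_conjTranspose _ (isHermitian_tubeH L M Λ e U θ')) _ hψ h1
  have hp := hgauge θ
  have hm := hgauge (-θ)
  rw [tubeEnergy_neg] at hm
  rw [re_expect_gauged_tubeH L M Λ e hL] at hp hm
  -- add the two bounds: pointwise the weights combine to `(2 - 2cos(θ/L))·[longitudinal]`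
  have hsum : (∑ x : Λ, ∑ y : Λ, ∑ σ : Fin 2, if (tubeGraph e).Adj x y then
      ((1 - (if (e x).1 = (e y).1 + 1 ∧ (e x).2 = (e y).2 then Complex.exp (((θ / L : ℝ) : ℂ) * Complex.I)
        else if (e y).1 = (e x).1 + 1 ∧ (e x).2 = (e y).2 then Complex.exp (-(((θ / L : ℝ) : ℂ) * Complex.I))
        else 1)) * expect (creation (orb x σ) * annihilation (orb y σ)) ψ).re else 0) +
      (∑ x : Λ, ∑ y : Λ, ∑ σ : Fin 2, if (tubeGraph e).Adj x y then
      ((1 - (if (e x).1 = (e y).1 + 1 ∧ (e x).2 = (e y).2 then Complex.exp ((((-θ) / L : ℝ) : ℂ) * Complex.I)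
        else if (e y).1 = (e x).1 + 1 ∧ (e x).2 = (e y).2 then Complex.exp (-((((-θ) / L : ℝ) : ℂ) * Complex.I))
        else 1)) * expect (creation (orb x σ) * annihilation (orb y σ)) ψ).re else 0) =
      (2 - 2 * Real.cos (θ / L)) * ∑ a : ZMod L, ∑ b : ZMod M, ∑ σ : Fin 2,
        (expect (creation (orb (e.symm (a, b)) σ) * annihilation (orb (e.symm (a - 1, b)) σ) +
          creation (orb (e.symm (a - 1, b)) σ) * annihilation (orb (e.symm (a, b)) σ)) ψ).re := by
    rw [← Finset.sum_add_distrib]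
    have hpt : ∀ x : Λ, (∑ y : Λ, ∑ σ : Fin 2, (if (tubeGraph e).Adj x y then
        ((1 - (if (e x).1 = (e y).1 + 1 ∧ (e x).2 = (e y).2 then Complex.exp (((θ / L : ℝ) : ℂ) * Complex.I)
          else if (e y).1 = (e x).1 + 1 ∧ (e x).2 = (e y).2 then Complex.exp (-(((θ / L : ℝ) : ℂ) * Complex.I))
          else 1)) * expect (creation (orb x σ) * annihilation (orb y σ)) ψ).re else 0)) +
        (∑ y : Λ, ∑ σ : Fin 2, (if (tubeGraph e).Adj x y then
        ((1 - (if (e x).1 = (e y).1 + 1 ∧ (e x).2 = (e y).2 then Complex.exp ((((-θ) / L : ℝ) : ℂ) * Complex.I)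
          else if (e y).1 = (e x).1 + 1 ∧ (e x).2 = (e y).2 then Complex.exp (-((((-θ) / L : ℝ) : ℂ) * Complex.I))
          else 1)) * expect (creation (orb x σ) * annihilation (orb y σ)) ψ).re else 0)) =
        ∑ y : Λ, ∑ σ : Fin 2, (2 - 2 * Real.cos (θ / L)) *
          (((if (e x).1 = (e y).1 + 1 ∧ (e x).2 = (e y).2 then 1 else 0) +
            (if (e y).1 = (e x).1 + 1 ∧ (e x).2 = (e y).2 then 1 else 0)) *
            (expect (creation (orb x σ) * annihilation (orb y σ)) ψ).re) := by
      intro x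
      rw [← Finset.sum_add_distrib]
      refine Finset.sum_congr rfl fun y _ => ?_
      rw [← Finset.sum_add_distrib]
      refine Finset.sum_congr rfl fun σ _ => ?_
      exact summand_pm_eq L M Λ e hL θ x y _
    rw [Finset.sum_congr rfl fun x _ => hpt x, sum_longitudinal_mul_eq]
    congr 1
    refine Finset.sum_congr rfl fun a _ => Finset.sum_congr rfl fun b _ => Finset.sum_congr rfl fun σ _ => ?_
    rw [expect_add, Complex.add_re]
  linarith

/-- **`E(θ) - E(0) ≤ (1 - cos(θ/L))·K_ψ` for every normalised sector ground state** (`L ≥ 3`): the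
stiffness of the whole flux envelope is paid for by the longitudinal kinetic energy of any one
ground state. Scalapino–White–Zhang, PRB 47 (1993) 7995, §II; Paramekanti–Trivedi–Randeria, PRB 57
(1998) 11639, §III. [cite: ScalapinoWhiteZhang1993, §II] -/
theorem tubeEnergy_sub_le_kinetic (hL : 3 ≤ L) (U θ : ℝ) (N : ℕ) {ψ : Fock (Orb Λ)}
    (h1 : star ψ ⬝ᵥ ψ = 1) (hgs : IsGroundStateInSector (tubeH0 L M Λ e U) N 0 ψ) :
    tubeEnergy L M Λ e U θ N - tubeEnergy L M Λ e U 0 N ≤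
      (1 - Real.cos (θ / L)) * ∑ a : ZMod L, ∑ b : ZMod M, ∑ σ : Fin 2,
        (expect (creation (orb (e.symm (a, b)) σ) * annihilation (orb (e.symm (a - 1, b)) σ) +
          creation (orb (e.symm (a - 1, b)) σ) * annihilation (orb (e.symm (a, b)) σ)) ψ).re := by
  have h := two_mul_tubeEnergy_le_kinetic L M Λ e hL U θ N hgs.1 h1
  -- for a sector ground state `Re⟨ψ, H₀ψ⟩ = E(0)`
  have hE : (expect (tubeH0 L M Λ e U) ψ).re = tubeEnergy L M Λ e U 0 N := by
    rw [expect, hgs.2.2, dotProduct_smul, h1, smul_eq_mul, mul_one, Complex.ofReal_re,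
      tubeEnergy_zero]
  rw [hE] at h
  linarith

/-- **KINETIC FLOOR from a stiffness floor.** On the pure Hubbard tube `ℤ/L × ℤ/M` (`L ≥ 3`), if the
twist stiffness per site at `(U, δ)` obeys `0 < d₀ ≤ ρ̃_{L,M}(U, δ)`, then EVERY normalised ground
state `ψ` of `tubeH0` in the sector `(N_{L,M}(δ), S^z = 0)` carries longitudinal kinetic energy at
least `d₀` per bond: `d₀·L·M ≤ K_ψ` (the lattice f-sum inequality `D_s/π ≤ ⟨-k_x⟩` as a constraint on
`ψ`; uses `1 - cos x ≤ x²/2`). Scalapino–White–Zhang, PRB 47 (1993) 7995, §II; Paramekanti–Trivedi–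
Randeria, PRB 57 (1998) 11639, eq. (ke-bd). [cite: ScalapinoWhiteZhang1993, §II] -/
theorem kineticFloor_of_stiffness (hL : 3 ≤ L) (U : ℝ) {δ d₀ : ℝ} (hd₀ : 0 < d₀)
    (hd : d₀ ≤ tubeStiffness L M Λ e U δ) {ψ : Fock (Orb Λ)} (h1 : star ψ ⬝ᵥ ψ = 1)
    (hgs : IsGroundStateInSector (tubeH0 L M Λ e U) (tubeFilling L M δ) 0 ψ) :
    d₀ * (L : ℝ) * (M : ℝ) ≤ ∑ a : ZMod L, ∑ b : ZMod M, ∑ σ : Fin 2,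
        (expect (creation (orb (e.symm (a, b)) σ) * annihilation (orb (e.symm (a - 1, b)) σ) +
          creation (orb (e.symm (a - 1, b)) σ) * annihilation (orb (e.symm (a, b)) σ)) ψ).re := by
  set K := ∑ a : ZMod L, ∑ b : ZMod M, ∑ σ : Fin 2,
        (expect (creation (orb (e.symm (a, b)) σ) * annihilation (orb (e.symm (a - 1, b)) σ) +
          creation (orb (e.symm (a - 1, b)) σ) * annihilation (orb (e.symm (a, b)) σ)) ψ).re with hK
  have hLr : (0 : ℝ) < L := by exact_mod_cast (show 0 < L by omega)
  have hMr : (0 : ℝ) < M := by exact_mod_cast Nat.pos_of_ne_zero (NeZero.ne M)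
  have hπ : (0 : ℝ) < (Real.pi / 3) ^ 2 := by positivity
  -- the stiffness floor as an energy floor: `d₀ (π/3)² M/(2L) ≤ E(π/3) - E(0)`
  have hstiff : d₀ * ((Real.pi / 3) ^ 2 * (M : ℝ)) / (2 * L) ≤
      tubeEnergy L M Λ e U (Real.pi / 3) (tubeFilling L M δ) -
        tubeEnergy L M Λ e U 0 (tubeFilling L M δ) := by
    rw [tubeStiffness_eq] at hd
    rw [div_le_iff₀ (by positivity)]
    have hden : (0 : ℝ) < (Real.pi / 3) ^ 2 * (M : ℝ) := by positivity
    have := (le_div_iff₀ hden).1 hd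
    nlinarith
  -- the energy ceiling by the kinetic energy of `ψ`
  have hkin := tubeEnergy_sub_le_kinetic L M Λ e hL U (Real.pi / 3) (tubeFilling L M δ) h1 hgs
  rw [← hK] at hkin
  have hcos : 1 - Real.cos (Real.pi / 3 / L) ≤ (Real.pi / 3 / L) ^ 2 / 2 := by
    have := two_sub_two_mul_cos_le_sq (Real.pi / 3 / L)
    linarith
  have hc0 : 0 ≤ 1 - Real.cos (Real.pi / 3 / L) := by linarith [Real.cos_le_one (Real.pi / 3 / L)]
  -- `K > 0`: otherwise the ceiling would be nonpositive while the floor is positive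
  have hKpos : 0 < K := by
    by_contra hK0
    push Not at hK0
    have h0 : (1 - Real.cos (Real.pi / 3 / L)) * K ≤ 0 := mul_nonpos_of_nonneg_of_nonpos hc0 hK0
    have hpos : 0 < d₀ * ((Real.pi / 3) ^ 2 * (M : ℝ)) / (2 * L) := by positivity
    linarith
  have hchain : d₀ * ((Real.pi / 3) ^ 2 * (M : ℝ)) / (2 * L) ≤ (Real.pi / 3 / L) ^ 2 / 2 * K := by
    calc d₀ * ((Real.pi / 3) ^ 2 * (M : ℝ)) / (2 * L)
        ≤ (1 - Real.cos (Real.pi / 3 / L)) * K := hstiff.trans hkin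
      _ ≤ (Real.pi / 3 / L) ^ 2 / 2 * K := mul_le_mul_of_nonneg_right hcos hKpos.le
  -- clear denominators: multiply by `2L²/(π/3)²`
  have hL0 : (L : ℝ) ≠ 0 := hLr.ne'
  have key : d₀ * ((Real.pi / 3) ^ 2 * (M : ℝ)) / (2 * L) * (2 * L ^ 2 / (Real.pi / 3) ^ 2) =
      d₀ * L * M := by
    field_simp
  have key2 : (Real.pi / 3 / L) ^ 2 / 2 * K * (2 * L ^ 2 / (Real.pi / 3) ^ 2) = K := by
    field_simp
  have hfac : 0 ≤ 2 * (L : ℝ) ^ 2 / (Real.pi / 3) ^ 2 := by positivity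
  have := mul_le_mul_of_nonneg_right hchain hfac
  rwa [key, key2] at this

/-- **Under the cruxes' hypothesis.** If `UniformThermo U δ d₀ k₀ M₁ L₀` holds with `d₀ > 0`, then at
every admissible size (`L`, `M` even, `M₁ ≤ M ≤ L`, `L₀ ≤ L`, `L ≥ 3`) and for every labelling, every
normalised `(N_{L,M}(δ), S^z = 0)` sector ground state of the pure tube has `d₀·L·M ≤ K_ψ`.
[cite: ScalapinoWhiteZhang1993, §II] -/
theorem uniformThermo_kineticFloor {U δ d₀ k₀ : ℝ} {M₁ L₀ : ℕ} (hd₀ : 0 < d₀)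
    (h : UniformThermo U δ d₀ k₀ M₁ L₀) (hLe : Even L) (hMe : Even M) (hM₁ : M₁ ≤ M) (hML : M ≤ L)
    (hL₀ : L₀ ≤ L) (hL : 3 ≤ L) {ψ : Fock (Orb Λ)} (h1 : star ψ ⬝ᵥ ψ = 1)
    (hgs : IsGroundStateInSector (tubeH0 L M Λ e U) (tubeFilling L M δ) 0 ψ) :
    d₀ * (L : ℝ) * (M : ℝ) ≤ ∑ a : ZMod L, ∑ b : ZMod M, ∑ σ : Fin 2,
        (expect (creation (orb (e.symm (a, b)) σ) * annihilation (orb (e.symm (a - 1, b)) σ) +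
          creation (orb (e.symm (a - 1, b)) σ) * annihilation (orb (e.symm (a, b)) σ)) ψ).re :=
  kineticFloor_of_stiffness L M Λ e hL U hd₀ (h L M hLe hMe hM₁ hML hL₀ Λ e).1 h1 hgs

end KineticFloor

/-- **KINETIC FLOOR, closed form** (all binders universally quantified; the registered sub-goal
`kineticFloor` of crux stmt-HubbardSuperconductivity-16311 — card `twist-transfer-floors`'
`KineticFloor`, strategist census gen 1 S2): under `UniformThermo` with `d₀ > 0`, every normalised
sector ground state of every admissible untwisted tube has longitudinal kinetic energy
`Σ_{a,b,σ} Re⟨ψ, (c†_{(a,b)σ}c_{(a-1,b)σ} + c†_{(a-1,b)σ}c_{(a,b)σ}) ψ⟩ ≥ d₀·L·M`.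
[cite: ScalapinoWhiteZhang1993, §II] -/
theorem kineticFloor : ∀ (U δ d₀ k₀ : ℝ) (M₁ L₀ : ℕ), 0 < d₀ → UniformThermo U δ d₀ k₀ M₁ L₀ → ∀ (L M : ℕ) [NeZero L] [NeZero M], Even L → Even M → M₁ ≤ M → M ≤ L → L₀ ≤ L → 3 ≤ L → ∀ (Λ : Type) [LinearOrder Λ] [Fintype Λ] (e : Λ ≃ ZMod L × ZMod M) (ψ : Fock (Orb Λ)), star ψ ⬝ᵥ ψ = 1 → IsGroundStateInSector (tubeH0 L M Λ e U) (tubeFilling L M δ) 0 ψ → d₀ * (L : ℝ) * (M : ℝ) ≤ ∑ a : ZMod L, ∑ b : ZMod M, ∑ σ : Fin 2, (expect (creation (orb (e.symm (a, b)) σ) * annihilation (orb (e.symm (a - 1, b)) σ) + creation (orb (e.symm (a - 1, b)) σ) * annihilation (orb (e.symm (a, b)) σ)) ψ).re :=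
  fun _U _δ _d₀ _k₀ _M₁ _L₀ hd₀ h L M _ _ hLe hMe hM₁ hML hL₀ hL Λ _ _ e _ψ h1 hgs =>
    uniformThermo_kineticFloor L M Λ e hd₀ h hLe hMe hM₁ hML hL₀ hL h1 hgs

end Summit.HubbardSuperconductivity.HubbardSuperconductivity.Theorems.WidthHaldane

end
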